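import Mathlib
import HarnessLib

/-!
# Cluster matching: the combinatorial core of Karnin–Shpilka rank-distance clustering (ORBIT currency)

Route MonotoneRestoration, crux `OrbitRestorationQP` (stmt-ValiantsHypothesis-18293), line `depth-three-rung`,
registered stub `stub_sigmaPiSigmaKValue` (A_k: the `ΣΠΣ(k)` sub-rung from the `ΠΣ` sub-rung and the Saxena–Seshadhri
rank bound).  Namespace `Summit.ValiantsHypothesis.ValiantsHypothesis.Theorems.ClusterMatching`.  Route-independent
(no `Theses` import); pure finite combinatorics, no polynomials.

This file is layer L3 (a) of the formalisation plan of the crux workfile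
`Cruxes/OrbitRestorationQP/Lines/depth-three-rung-stubA-bounded-fanin.md` (§2 (b), §8, §9 "abstract MATCHING LEMMA"):
**the abstract matching lemma** (`MatchingData.exists_match_left`, `MatchingData.exists_match_right`).  Terms are
indexed by `ι ⊕ ι` (the terms of a minimal representation `C` on the left, those of its image `γ C` under a symmetry
on the right) and valued in an additive commutative group; the whole signed family sums to zero; `Δ` is a
pseudo-metric on `ι ⊕ ι` whose restrictions to the two copies of `ι` agree (`Δ` is `γ`-invariant); every MINIMAL
vanishing sub-family has all pairwise distances `≤ R` (the rank bound) and meets both copies (minimality of `C` and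
of `γ C`).  If a labelling `cl : ι → α` of the terms has cluster diameter `≤ Θ` and separation `> 2R + Θ`, then every
cluster sum on the left is cancelled by one cluster sum on the right and conversely.  The proof decomposes the whole
family into minimal vanishing sub-families (`exists_decomposition`) and checks that a block meeting the union of a
left fibre and its matched right fibre lies inside it (two triangle inequalities).  The companion file
`…GoodScale.lean` produces such labellings (single-linkage clustering at a good scale).

Everything is proved. [folklore; cite: KarninShpilka2009 (rank distance, canonical clustering); SaxenaSeshadhri2013]
-/

open Finset

-- `Summit.ValiantsHypothesis.ValiantsHypothesis.…` is the tree's single-conjunct layout (Sub = Summit).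
set_option linter.dupNamespace false

namespace Summit.ValiantsHypothesis.ValiantsHypothesis.Theorems

namespace ClusterMatching

universe u v

section Matching

variable {κ : Type u} [DecidableEq κ] {M : Type v} [AddCommGroup M]

/-- A sub-family VANISHES if its values sum to zero. [folklore] -/
def Vanishing (val : κ → M) (s : Finset κ) : Prop := ∑ x ∈ s, val x = 0

/-- A MINIMAL vanishing sub-family: nonempty, vanishing, and no nonempty proper sub-family vanishes. [folklore] -/
def MinVanishing (val : κ → M) (s : Finset κ) : Prop :=
  s.Nonempty ∧ Vanishing val s ∧ ∀ t, t ⊂ s → t.Nonempty → ¬ Vanishing val t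

omit [DecidableEq κ] in
/-- A nonempty vanishing family contains a minimal vanishing sub-family. [folklore] -/
theorem exists_minVanishing_subset (val : κ → M) {s : Finset κ} (hs : s.Nonempty) (hv : Vanishing val s) :
    ∃ t ⊆ s, MinVanishing val t := by
  classical
  -- a nonempty vanishing subset of minimal cardinality
  let P : Finset (Finset κ) := s.powerset.filter fun t => t.Nonempty ∧ Vanishing val t
  have hP : s ∈ P := by simp [P, hs, hv]
  obtain ⟨t, htP, hmin⟩ := exists_min_image P Finset.card ⟨s, hP⟩
  simp only [P, mem_filter, mem_powerset] at htP
  refine ⟨t, htP.1, htP.2.1, htP.2.2, fun t' ht' hne hvan => ?_⟩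
  have ht'P : t' ∈ P := by
    simp only [P, mem_filter, mem_powerset]
    exact ⟨ht'.1.trans htP.1, hne, hvan⟩
  exact absurd (hmin t' ht'P) (not_le.2 (card_lt_card ht'))

/-- **Decomposition into minimal vanishing sub-families.**  Every vanishing family is a disjoint union of
minimal vanishing sub-families. [folklore] -/
theorem exists_decomposition (val : κ → M) :
    ∀ s : Finset κ, Vanishing val s →
      ∃ 𝒮 : Finset (Finset κ), (∀ t ∈ 𝒮, MinVanishing val t) ∧ (∀ t ∈ 𝒮, t ⊆ s) ∧
        (𝒮 : Set (Finset κ)).PairwiseDisjoint id ∧ s = 𝒮.biUnion id := by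
  classical
  intro s
  induction s using Finset.strongInduction with
  | H s ih =>
    intro hv
    by_cases hs : s.Nonempty
    · obtain ⟨t, hts, ht⟩ := exists_minVanishing_subset val hs hv
      have hlt : s \ t ⊂ s := sdiff_ssubset hts ht.1
      have hv' : Vanishing val (s \ t) := by
        have h := sum_sdiff (f := val) hts
        have h1 : ∑ x ∈ t, val x = 0 := ht.2.1
        unfold Vanishing at hv ⊢
        rw [hv, h1, add_zero] at h
        exact h
      obtain ⟨𝒮, h1, h2, h3, h4⟩ := ih (s \ t) hlt hv'
      have htn : t ∉ 𝒮 := by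
        intro htm
        obtain ⟨x, hx⟩ := ht.1
        have := h2 t htm hx
        rw [mem_sdiff] at this
        exact this.2 hx
      refine ⟨insert t 𝒮, ?_, ?_, ?_, ?_⟩
      · intro t' ht'
        rcases mem_insert.1 ht' with rfl | ht'
        · exact ht
        · exact h1 t' ht'
      · intro t' ht'
        rcases mem_insert.1 ht' with rfl | ht'
        · exact hts
        · exact (h2 t' ht').trans sdiff_subset
      · rw [coe_insert]
        refine Set.PairwiseDisjoint.insert h3 fun t' ht' hne => ?_
        simp only [id]
        exact disjoint_of_subset_right (h2 t' ht') disjoint_sdiff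
      · rw [biUnion_insert, id, ← h4, union_sdiff_of_subset hts]
    · refine ⟨∅, by simp, by simp, by simp, ?_⟩
      rw [not_nonempty_iff_eq_empty.1 hs]; simp

variable {ι : Type u} [Fintype ι] [DecidableEq ι] {α : Type*} [DecidableEq α]

/-- The data of the matching lemma: a signed valuation of the `2m` terms indexed by `ι ⊕ ι`, a pseudo-metric `Δ`
on them whose restrictions to both copies of `ι` are one pseudo-metric `δ`, the rank-bound constant `R`, and the
two standing hypotheses — minimal vanishing sub-families are `R`-close and MIXED (they meet both copies).
[folklore] -/
structure MatchingData (ι : Type u) [Fintype ι] (M : Type v) [AddCommGroup M] where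
  /-- the signed values (`T i` on the left, `-γ T i` on the right) -/
  val : ι ⊕ ι → M
  /-- the rank distance between terms -/
  Δ : (ι ⊕ ι) → (ι ⊕ ι) → ℕ
  /-- its common restriction to the two copies -/
  δ : ι → ι → ℕ
  /-- the rank-bound constant -/
  R : ℕ
  total : ∑ x, val x = 0
  symm : ∀ x y, Δ x y = Δ y x
  triangle : ∀ x y z, Δ x z ≤ Δ x y + Δ y z
  inl_inl : ∀ i j, Δ (Sum.inl i) (Sum.inl j) = δ i j
  inr_inr : ∀ i j, Δ (Sum.inr i) (Sum.inr j) = δ i j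
  close : ∀ s, MinVanishing val s → ∀ x ∈ s, ∀ y ∈ s, Δ x y ≤ R
  mixed : ∀ s : Finset (ι ⊕ ι), s.Nonempty → Vanishing val s →
    (∃ i, Sum.inl i ∈ s) ∧ ∃ j, Sum.inr j ∈ s

/-- A GOOD labelling of the index type at diameter `Θ`: equal labels are `Θ`-close, different labels are more than
`2R + Θ` apart. [folklore] -/
structure GoodLabelling (D : MatchingData ι M) (cl : ι → α) (Θ : ℕ) : Prop where
  diam : ∀ i j, cl i = cl j → D.δ i j ≤ Θ
  sep : ∀ i j, cl i ≠ cl j → 2 * D.R + Θ < D.δ i j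

namespace MatchingData

variable (D : MatchingData ι M)

/-- The mirrored data (swap the two copies of `ι`). [folklore] -/
def swap : MatchingData ι M where
  val := D.val ∘ Sum.swap
  Δ x y := D.Δ x.swap y.swap
  δ := D.δ
  R := D.R
  total := by
    rw [← D.total]
    exact Fintype.sum_equiv (Equiv.sumComm ι ι) _ _ fun x => rfl
  symm x y := D.symm _ _
  triangle x y z := D.triangle _ _ _
  inl_inl i j := D.inr_inr i j
  inr_inr i j := D.inl_inl i j
  close s hs x hx y hy := by
    have hs' : MinVanishing D.val (s.map (Equiv.sumComm ι ι).toEmbedding) := by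
      refine ⟨by simpa using hs.1, ?_, ?_⟩
      · unfold Vanishing; rw [sum_map]; exact hs.2.1
      · intro t ht hne hv
        have ht' : t.map (Equiv.sumComm ι ι).toEmbedding ⊂ s := by
          have := Finset.map_ssubset_map (f := (Equiv.sumComm ι ι).toEmbedding) |>.2 ht
          simpa [Finset.map_map] using this
        refine hs.2.2 _ ht' (by simpa using hne) ?_
        unfold Vanishing at hv ⊢
        rw [sum_map]
        simpa using hv
    have := D.close _ hs' x.swap (by simpa using hx) y.swap (by simpa using hy)
    exact this
  mixed s hne hv := by
    have hv' : Vanishing D.val (s.map (Equiv.sumComm ι ι).toEmbedding) := by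
      unfold Vanishing at hv ⊢; rw [sum_map]; exact hv
    obtain ⟨⟨i, hi⟩, ⟨j, hj⟩⟩ := D.mixed _ (by simpa using hne) hv'
    refine ⟨⟨j, ?_⟩, ⟨i, ?_⟩⟩
    · simpa using hj
    · simpa using hi

omit [DecidableEq ι] [DecidableEq α] in
/-- A good labelling for `D` is a good labelling for the mirrored data. [folklore] -/
theorem goodLabelling_swap {cl : ι → α} {Θ : ℕ} (h : GoodLabelling D cl Θ) : GoodLabelling D.swap cl Θ :=
  ⟨h.diam, h.sep⟩

variable {D}

omit [DecidableEq ι] in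
/-- In a minimal vanishing sub-family, two LEFT terms carry the same label. [folklore] -/
theorem cl_eq_of_inl_mem {cl : ι → α} {Θ : ℕ} (h : GoodLabelling D cl Θ) {s : Finset (ι ⊕ ι)}
    (hs : MinVanishing D.val s) {i j : ι} (hi : Sum.inl i ∈ s) (hj : Sum.inl j ∈ s) : cl i = cl j := by
  by_contra hne
  have h1 := D.close s hs _ hi _ hj
  rw [D.inl_inl] at h1
  have h2 := h.sep i j hne
  omega

omit [DecidableEq ι] in
/-- In a minimal vanishing sub-family, two RIGHT terms carry the same label. [folklore] -/
theorem cl_eq_of_inr_mem {cl : ι → α} {Θ : ℕ} (h : GoodLabelling D cl Θ) {s : Finset (ι ⊕ ι)}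
    (hs : MinVanishing D.val s) {i j : ι} (hi : Sum.inr i ∈ s) (hj : Sum.inr j ∈ s) : cl i = cl j := by
  by_contra hne
  have h1 := D.close s hs _ hi _ hj
  rw [D.inr_inr] at h1
  have h2 := h.sep i j hne
  omega

omit [DecidableEq ι] in
/-- **Matching is well defined**: if two minimal vanishing sub-families link left labels `cl i`, `cl i'` to ONE right
label, then `cl i = cl i'` (triangle inequality through the right cluster, of diameter `≤ Θ`, against the
separation `> 2R + Θ`). [folklore] -/
theorem cl_eq_of_linked {cl : ι → α} {Θ : ℕ} (h : GoodLabelling D cl Θ) {s s' : Finset (ι ⊕ ι)}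
    (hs : MinVanishing D.val s) (hs' : MinVanishing D.val s') {i j i' j' : ι}
    (hi : Sum.inl i ∈ s) (hj : Sum.inr j ∈ s) (hi' : Sum.inl i' ∈ s') (hj' : Sum.inr j' ∈ s')
    (hjj : cl j = cl j') : cl i = cl i' := by
  by_contra hne
  have h1 : D.Δ (Sum.inl i) (Sum.inr j) ≤ D.R := D.close s hs _ hi _ hj
  have h2 : D.Δ (Sum.inr j) (Sum.inr j') ≤ Θ := by rw [D.inr_inr]; exact h.diam j j' hjj
  have h3 : D.Δ (Sum.inr j') (Sum.inl i') ≤ D.R := by rw [D.symm]; exact D.close s' hs' _ hi' _ hj'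
  have h4 := h.sep i i' hne
  have h5 : D.Δ (Sum.inl i) (Sum.inl i') ≤ D.R + Θ + D.R :=
    (D.triangle _ (Sum.inr j') _).trans
      (Nat.add_le_add ((D.triangle _ (Sum.inr j) _).trans (Nat.add_le_add h1 h2)) h3)
  rw [D.inl_inl] at h5
  omega

omit [DecidableEq ι] in
/-- The mirror of `cl_eq_of_linked`: two right labels linked to one left label coincide. [folklore] -/
theorem cl_eq_of_linked' {cl : ι → α} {Θ : ℕ} (h : GoodLabelling D cl Θ) {s s' : Finset (ι ⊕ ι)}
    (hs : MinVanishing D.val s) (hs' : MinVanishing D.val s') {i j i' j' : ι}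
    (hi : Sum.inl i ∈ s) (hj : Sum.inr j ∈ s) (hi' : Sum.inl i' ∈ s') (hj' : Sum.inr j' ∈ s')
    (hii : cl i = cl i') : cl j = cl j' := by
  by_contra hne
  have h1 : D.Δ (Sum.inr j) (Sum.inl i) ≤ D.R := by rw [D.symm]; exact D.close s hs _ hi _ hj
  have h2 : D.Δ (Sum.inl i) (Sum.inl i') ≤ Θ := by rw [D.inl_inl]; exact h.diam i i' hii
  have h3 : D.Δ (Sum.inl i') (Sum.inr j') ≤ D.R := D.close s' hs' _ hi' _ hj'
  have h4 := h.sep j j' hne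
  have h5 : D.Δ (Sum.inr j) (Sum.inr j') ≤ D.R + Θ + D.R :=
    (D.triangle _ (Sum.inl i') _).trans
      (Nat.add_le_add ((D.triangle _ (Sum.inl i) _).trans (Nat.add_le_add h1 h2)) h3)
  rw [D.inr_inr] at h5
  omega

/-- The union of the left fibre of `a` and the right fibre of `b`. [folklore] -/
def fibre2 (cl : ι → α) (a b : α) : Finset (ι ⊕ ι) :=
  (univ.filter fun i => cl i = a).disjSum (univ.filter fun j => cl j = b)

omit [DecidableEq ι] in
/-- Membership of a left term in `fibre2`. [folklore] -/
@[simp] theorem inl_mem_fibre2 {cl : ι → α} {a b : α} {i : ι} :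
    (Sum.inl i : ι ⊕ ι) ∈ fibre2 cl a b ↔ cl i = a := by
  simp [fibre2, Finset.inl_mem_disjSum]

omit [DecidableEq ι] in
/-- Membership of a right term in `fibre2`. [folklore] -/
@[simp] theorem inr_mem_fibre2 {cl : ι → α} {a b : α} {j : ι} :
    (Sum.inr j : ι ⊕ ι) ∈ fibre2 cl a b ↔ cl j = b := by
  simp [fibre2, Finset.inr_mem_disjSum]

/-- **THE MATCHING LEMMA (left to right).**  Under a good labelling, every left cluster sum is cancelled by one right
cluster sum: for every label `a` there is a label `b` with `Σ_{cl i = a} val (inl i) + Σ_{cl j = b} val (inr j) = 0`.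
[folklore; cite: KarninShpilka2009] -/
theorem exists_match_left {cl : ι → α} {Θ : ℕ} (h : GoodLabelling D cl Θ) (a : α) :
    ∃ b : α, ∑ i ∈ univ.filter (fun i => cl i = a), D.val (Sum.inl i) +
      ∑ j ∈ univ.filter (fun j => cl j = b), D.val (Sum.inr j) = 0 := by
  classical
  -- the decomposition of the whole family
  obtain ⟨𝒮, hmin, -, hdisj, huniv⟩ := exists_decomposition D.val univ D.total
  have hcover : ∀ x : ι ⊕ ι, ∃ t ∈ 𝒮, x ∈ t := by
    intro x
    have hx := (Finset.ext_iff.1 huniv x).1 (mem_univ x)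
    rw [mem_biUnion] at hx
    simpa using hx
  by_cases ha : ∃ i₀, cl i₀ = a
  · obtain ⟨i₀, hi₀⟩ := ha
    obtain ⟨t₀, ht₀, hit₀⟩ := hcover (Sum.inl i₀)
    obtain ⟨-, ⟨j₀, hj₀⟩⟩ := D.mixed t₀ (hmin t₀ ht₀).1 (hmin t₀ ht₀).2.1
    refine ⟨cl j₀, ?_⟩
    -- every block meeting `U = fibre2 cl a (cl j₀)` lies inside it
    set U := fibre2 cl a (cl j₀) with hU
    have hblock : ∀ t ∈ 𝒮, ∀ x ∈ t, x ∈ U → t ⊆ U := by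
      intro t ht x hx hxU y hy
      have hmt := hmin t ht
      rw [hU] at hxU ⊢
      -- a left and a right member of `t`
      obtain ⟨⟨i₁, hi₁⟩, ⟨j₁, hj₁⟩⟩ := D.mixed t hmt.1 hmt.2.1
      -- the left members of `t` have label `a`, the right ones label `cl j₀`
      have hleft : cl i₁ = a := by
        rcases x with i | j
        · rw [inl_mem_fibre2] at hxU
          rw [cl_eq_of_inl_mem h hmt hi₁ hx, hxU]
        · rw [inr_mem_fibre2] at hxU
          have := cl_eq_of_linked h hmt (hmin t₀ ht₀) hi₁ hj₁ hit₀ hj₀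
            (by rw [cl_eq_of_inr_mem h hmt hj₁ hx, hxU])
          rw [this, hi₀]
      have hright : cl j₁ = cl j₀ :=
        cl_eq_of_linked' h hmt (hmin t₀ ht₀) hi₁ hj₁ hit₀ hj₀ (by rw [hleft, hi₀])
      rcases y with i | j
      · rw [inl_mem_fibre2, cl_eq_of_inl_mem h hmt hy hi₁, hleft]
      · rw [inr_mem_fibre2, cl_eq_of_inr_mem h hmt hy hj₁, hright]
    -- `U` is the disjoint union of the blocks it contains
    have hUeq : U = (𝒮.filter fun t => t ⊆ U).biUnion id := by
      ext x
      simp only [mem_biUnion, mem_filter, id]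
      constructor
      · intro hx
        obtain ⟨t, ht, hxt⟩ := hcover x
        exact ⟨t, ⟨ht, hblock t ht x hxt hx⟩, hxt⟩
      · rintro ⟨t, ⟨-, htU⟩, hxt⟩
        exact htU hxt
    have hsumU : ∑ x ∈ U, D.val x = 0 := by
      rw [hUeq, sum_biUnion]
      · refine sum_eq_zero fun t ht => ?_
        exact (hmin t (mem_filter.1 ht).1).2.1
      · intro t ht t' ht' hne
        exact hdisj (mem_filter.1 ht).1 (mem_filter.1 ht').1 hne
    -- split the sum over `U` into its left and right parts
    have hsplit : ∑ x ∈ U, D.val x =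
        ∑ i ∈ univ.filter (fun i => cl i = a), D.val (Sum.inl i) +
          ∑ j ∈ univ.filter (fun j => cl j = cl j₀), D.val (Sum.inr j) := by
      rw [hU, fibre2, Finset.sum_disjSum]
    rw [← hsplit, hsumU]
  · -- empty left fibre: match it with itself if empty on the right, else anything works only if... take `b = a`
    refine ⟨a, ?_⟩
    have h1 : univ.filter (fun i => cl i = a) = ∅ := by
      rw [filter_eq_empty_iff]
      intro i _ hi
      exact ha ⟨i, hi⟩
    rw [h1, sum_empty, zero_add, sum_empty]

/-- **THE MATCHING LEMMA (right to left).**  Under a good labelling, every right cluster sum is cancelled by one left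
cluster sum. [folklore; cite: KarninShpilka2009] -/
theorem exists_match_right {cl : ι → α} {Θ : ℕ} (h : GoodLabelling D cl Θ) (b : α) :
    ∃ a : α, ∑ i ∈ univ.filter (fun i => cl i = a), D.val (Sum.inl i) +
      ∑ j ∈ univ.filter (fun j => cl j = b), D.val (Sum.inr j) = 0 := by
  classical
  obtain ⟨a, ha⟩ := exists_match_left (D := D.swap) (D.goodLabelling_swap h) b
  refine ⟨a, ?_⟩
  rw [add_comm]
  simpa [MatchingData.swap] using ha

end MatchingData

end Matching

end ClusterMatching

end Summit.ValiantsHypothesis.ValiantsHypothesis.Theorems
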